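import Summits.BirchSwinnertonDyer.BirchSwinnertonDyer.Theorems.ThetaPartnerAtTwoSignedKatoUpToAtTwoOffTwoRobust
import Summits.BirchSwinnertonDyer.BirchSwinnertonDyer.Theorems.ThetaPartnerAtTwoSignedKatoUpToAtTwoFineRestriction
import Summits.BirchSwinnertonDyer.BirchSwinnertonDyer.Theorems.ThetaPartnerAtTwoSignedKatoUpToAtTwoFineSandwich
import HarnessLib

/-!
# Route `ThetaPartnerAtTwo` (TP2), crux K3 `SignedKatoDivisibilityUpToAtTwo` (item stmt-BirchSwinnertonDyer-20308),
# line `colemanrat` v3: **K3 BY NAME, modulo print, from the LOCALISED `2`-robust package** — the (PT) clause of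
# the width seat's `RobustZetaSpanPackageTwo` (crux workfile `W3_PackageTwoSketch.lean`) WITHOUT `Y = X₀`, WITHOUT the
# map `k : X⁺ → X₀` and WITHOUT the global cover «`ker k ⊆ range j`»: the fine dual is the canonical one, `k` is
# kernel-built (`…FineRestriction`), and the cover is reduced — losing one factor `2` at the real places — to the
# LOCAL statement «every character of `Sel⁺(E/ℚ_∞)` vanishing on the classes locally trivial above `2` lies in
# `2^m · range j`» (`…FineSandwich`). What is left GLOBAL in (PT) is reciprocity `2^m · j ∘ col = 0` (Poitou–Tate) alone.

Width seat `bsd-wall-tp2-p2x-w3` g2 (cell `bsd-wall`). HONEST FRAMING: THEOREMS ONLY — no definition, no named fact, no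
instance, no `sorry`; the K3-level theorems are CONDITIONAL on the displayed hypotheses (Kato Thm. 13.4 (2) at `p = 2` and
Gross–Zagier–Kolyvagin BY NAME; one research package at `p = 2`); closes no item (`proof.conditional`); BSD is NOT proved by
any of this.

## What is proved

* §1 `C_two_smul_eq_two_nsmul`, `pow_succ_smul_eq` — bookkeeping: `C(2) • x = 2 • x`, `C(2)^{m+1} • x = C(2)^m • (2 • x)` in
  any `Λ`-module.
* §2 `signedKatoDivisibilityUpToAtTwo_of_localRobustPackageTwo_of_pub` — K3 from `h134`, `h17` and, per habitat datum, dual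
  datum `D` (torsion) and height-one `𝔭 ∌ 2`: pinned `I`, an abstract `Λ`-module `P` with `ι : P → Λ` (kernel killed by `2^m`),
  `col : 𝐇¹ → P`, `j : P → X⁺` with RECIPROCITY `2^m · j (col x) = 0` and LOCAL COVER «`D.toDual x` vanishes on
  `Sel⁺_∞ ∩ Str₂` ⟹ `2^m · x ∈ range j`», and a genuine `2`-adic Euler-system class `s` with `ℓ_𝔭(Λ/(ι col s)) ≤ ℓ_𝔭(Λ/(L♭))`.
  Proof: `Y :=` `W.fineSelmerDualData κ hγ`, `k :=` `exists_fineRestrict_package`, cover for `k` from the local cover applied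
  to `2 • x` (`FineSandwich.toDual_two_nsmul_apply_eq_zero` + `FineRestriction.fineRestrict_eq_zero_iff`), exponent `m + 1`;
  then `signedKatoDivisibilityUpToAtTwo_of_robustPackageTwo_of_pub`.
* §3 `signedKatoDivisibilityUpToAtTwo_of_localRobustZetaSpanPackageTwo_of_pub` — the same in the PRINT SHAPE (one `P, ι, col, m`
  per curve; `j` per `D`; zeta clause on the `Λ`-span of the genuine classes), via `…_of_robustZetaSpanPackageTwo_of_pub`.

`Str₂(s)` («`s` is locally trivial above `2`») is spelled, as in `…FineSandwich`, by the strict kernels of the fine datum: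
`∀ v ∋ 2, ∀ σ, conj_σ s ∈ (fineData E[2^∞] 2 v hv).strictKer (ker κ)`.

References: [Kobayashi2003] Thm. 6.2–6.3 (p. 11), (7.17)–(7.21), Thm. 7.3 (pp. 12–13); [Kato2004Asterisque] Thm. 13.4 (2) (p. 226),
§17.13 (p. 279); [Sprung2012] Def. 6.1 (p. 1495), §7 (p. 1499); [GreenbergLNM1716] §2 Prop. 2.1; [SerreGaloisCohomology1997] I §2.4;
[Darmon2004] Thm. 3.22.
-/

set_option autoImplicit false
-- the Theorems namespace of this sub repeats the summit name by design (D-0017 nested layout)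
set_option linter.dupNamespace false

noncomputable section

open scoped Classical MatrixGroups ModularForm NumberField

open CongruenceSubgroup WeierstrassCurve Field IsDedekindDomain NumberField
  Literature.NumberTheory.GaloisRepresentations
  Literature.NumberTheory.EllipticCurves Literature.NumberTheory.EllipticCurves.ModularForms
  Literature.NumberTheory.EllipticCurves.Module Literature.NumberTheory.EllipticCurves.Rank1Residual
  Literature.NumberTheory.EllipticCurves.Kobayashi2003 Literature.NumberTheory.EllipticCurves.Kato2004
  Literature.NumberTheory.EllipticCurves.Kato2004.EulerSystemValues Literature.NumberTheory.EllipticCurves.GreenbergSelmer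
  ZpExtension Summit.BirchSwinnertonDyer.Rank1Residual.Supersingular
  Summit.BirchSwinnertonDyer.BirchSwinnertonDyer.Theses.ThetaPartnerAtTwo

namespace Summit.BirchSwinnertonDyer.BirchSwinnertonDyer.Theorems

namespace SignedKatoOffTwo

/-! ## §1 Bookkeeping in `Λ`-modules: `C(2) • x = 2 • x` -/

section Bookkeeping

variable {p : ℕ} [Fact p.Prime] {X : Type*} [AddCommGroup X] [_root_.Module (IwasawaAlgebra p) X]

/-- `C(2) • x = 2 • x` in any `Λ`-module (`C` is a ring map). [folklore] -/
theorem C_two_smul_eq_two_nsmul (x : X) : (PowerSeries.C (2 : ℤ_[p]) : IwasawaAlgebra p) • x = 2 • x := by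
  rw [map_ofNat, two_smul, two_nsmul]

/-- `C(2)^{m+1} • x = C(2)^m • (2 • x)`. [folklore] -/
theorem C_two_pow_succ_smul (m : ℕ) (x : X) :
    (PowerSeries.C (2 : ℤ_[p]) : IwasawaAlgebra p) ^ (m + 1) • x =
      (PowerSeries.C (2 : ℤ_[p]) : IwasawaAlgebra p) ^ m • (2 • x) := by
  rw [pow_succ, mul_smul, C_two_smul_eq_two_nsmul]

/-- `C(2)^m • y = 0 ⟹ C(2)^{m+1} • y = 0`. [folklore] -/
theorem C_two_pow_succ_smul_eq_zero {m : ℕ} {y : X}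
    (hy : (PowerSeries.C (2 : ℤ_[p]) : IwasawaAlgebra p) ^ m • y = 0) :
    (PowerSeries.C (2 : ℤ_[p]) : IwasawaAlgebra p) ^ (m + 1) • y = 0 := by
  rw [pow_succ', mul_smul, hy, smul_zero]

end Bookkeeping

/-! ## §2 K3 BY NAME from the LOCALISED `2`-robust package -/

section AtTwo

/-- **K3 `SignedKatoDivisibilityUpToAtTwo` BY NAME, MODULO PRINT, from the LOCALISED `2`-robust package.** Granted Kato Thm.
13.4 (2) at `p = 2` (`h134`) and Gross–Zagier–Kolyvagin (`h17`), K3 follows if for every habitat datum, pinned dual datum `D`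
of `Sel⁺(E/ℚ_∞)` (torsion) and height-one `𝔭 ∌ 2` there are: pinned `I` (`𝐇¹_Γ(T₂E)`), an abstract `Λ`-module `P` (the
local module at `2`), `Λ`-linear `ι : P → Λ` (Coleman; kernel killed by `2^m`), `col : 𝐇¹ → P`, `j : P → X⁺` with
RECIPROCITY `2^m · j (col x) = 0` and the LOCAL COVER «if `D.toDual x` vanishes on every `s ∈ Sel⁺(E/ℚ_∞)` that is locally
trivial above `2` (all conjugates of the strict kernel of the fine datum), then `2^m · x ∈ range j`», an exponent `m`, and a
genuine `2`-adic Euler-system class `s` with `ℓ_𝔭(Λ/(ι col s)) ≤ ℓ_𝔭(Λ/(L♭))`. NO fine dual `Y`, NO `k : X⁺ → X₀`, NO global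
cover: `Y` is the canonical fine dual, `k` the kernel-built restriction (`FineRestriction.exists_fineRestrict_package`), and
`ker k` is covered with exponent `m + 1` by the fine sandwich (`FineSandwich.toDual_two_nsmul_apply_eq_zero`).
[cite: Kobayashi2003, (7.17)–(7.21), Thm. 7.3 (pp. 12–13)] [cite: Kato2004Asterisque, Thm. 13.4 (2) (p. 226), §17.13 (p. 279)]
[cite: GreenbergLNM1716, §2 Prop. 2.1 (p. 72)] [cite: SerreGaloisCohomology1997, I §2.4] [cite: Darmon2004, Thm. 3.22] -/
theorem signedKatoDivisibilityUpToAtTwo_of_localRobustPackageTwo_of_pub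
    (h134 : Kato2004.thm13_4_two_lengthAt_fineSelmerDual_le_of_isEulerSystemClassTwo)
    (h17 : rank_eq_analyticRank_of_analyticRank_le_one)
    (hR : ∀ (W : WeierstrassCurve ℚ) [W.IsElliptic] [W.IsGloballyMinimal],
      ¬ W.HasCM → W.analyticRank = 0 → GoodSS W 2 → W.frobeniusTrace 2 = 0 →
      ∀ (κ : ZpExtension ℚ 2) (γ : Field.absoluteGaloisGroup ℚ) (hκ : κ.IsCyclotomic),
        κ.IsTopGenerator γ → IsCyclotomicVariable 2 γ →
        ∀ [NeZero (W.conductorNorm ℤ)] (f : CuspForm (Gamma0 (W.conductorNorm ℤ)) 2),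
          IsNewformOf W f → ∀ (ϖ : ℚ), (ϖ : ℝ) * W.realPeriodRat = plusPeriod f →
        ∀ (Lplus Lminus : IwasawaAlgebra 2), IsPollackPair f 2 Lplus Lminus →
        ∀ (D : SignedSelmerDualData W κ γ 1) [ContinuousSMul ℤ_[2] (W.tateModule 2)]
          [Module.Free ℤ_[2] (W.tateModule 2)] [Module.Finite ℤ_[2] (W.tateModule 2)],
          Module.IsTorsion (IwasawaAlgebra 2) D.X →
          ∀ 𝔭 : PrimeSpectrum (IwasawaAlgebra 2), 𝔭.asIdeal.height = 1 →
            PowerSeries.C (2 : ℤ_[2]) ∉ 𝔭.asIdeal →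
          ∃ (I : Kato2004.IwasawaH1Data W 2 κ γ)
            (P : Type) (_ : AddCommGroup P) (_ : _root_.Module (IwasawaAlgebra 2) P)
            (ι : P →ₗ[IwasawaAlgebra 2] IwasawaAlgebra 2) (col : I.H →ₗ[IwasawaAlgebra 2] P)
            (j : P →ₗ[IwasawaAlgebra 2] D.X) (s : I.H) (m : ℕ),
            (∀ y, ι y = 0 → (PowerSeries.C (2 : ℤ_[2]) : IwasawaAlgebra 2) ^ m • y = 0) ∧
            (∀ x, (PowerSeries.C (2 : ℤ_[2]) : IwasawaAlgebra 2) ^ m • j (col x) = 0) ∧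
            (∀ x : D.X,
              (∀ t : signedSelmerInfty W κ 1,
                (∀ (v : HeightOneSpectrum (𝓞 ℚ)) (hv : ((2 : ℕ) : 𝓞 ℚ) ∈ v.asIdeal) (σ : absoluteGaloisGroup ℚ),
                  conjH1 κ.kerSubgroup (W.geomPrimaryTorsion 2) σ (t : W.subgroupH1 2 κ.kerSubgroup) ∈
                    (fineData (W.geomPrimaryTorsion 2) 2 v hv).strictKer κ.kerSubgroup) →
                D.toDual x t = 0) →
              (PowerSeries.C (2 : ℤ_[2]) : IwasawaAlgebra 2) ^ m • x ∈ LinearMap.range j) ∧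
            Kato2004.IsEulerSystemClassTwo W hκ I s ∧
            lengthAt (IwasawaAlgebra 2) (IwasawaAlgebra 2 ⧸ Ideal.span {ι (col s)}) 𝔭 ≤
              lengthAt (IwasawaAlgebra 2) (IwasawaAlgebra 2 ⧸ Ideal.span {kobayashiL 1 Lplus Lminus}) 𝔭) :
    SignedKatoDivisibilityUpToAtTwo := by
  refine signedKatoDivisibilityUpToAtTwo_of_robustPackageTwo_of_pub h134 h17
    fun W _ _ hcm hr hss ha κ γ hκ hγ hcv _ f hf ϖ hϖ Lplus Lminus hPP D _ _ _ hX 𝔭 h𝔭 hp𝔭 ↦ ?_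
  obtain ⟨I, P, _, _, ι, col, j, s, m, hι, hcj, hloc, hES, hdiv⟩ :=
    hR W hcm hr hss ha κ γ hκ hγ hcv f hf ϖ hϖ Lplus Lminus hPP D hX 𝔭 h𝔭 hp𝔭
  -- the canonical fine dual and the kernel-built restriction `k : X⁺ ↠ X₀`
  let Y : W.FineSelmerDualData κ γ := W.fineSelmerDualData κ hγ
  obtain ⟨k, hk, -, hkker, -⟩ := FineRestriction.exists_fineRestrict_package W κ hγ D Y
  refine ⟨I, Y, P, inferInstance, inferInstance, ι, col, j, k, s, m + 1,
    fun y hy ↦ C_two_pow_succ_smul_eq_zero (hι y hy), fun x ↦ C_two_pow_succ_smul_eq_zero (hcj x),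
    fun x hxk ↦ ?_, hES, hdiv⟩
  -- cover for `k`, exponent `m + 1`: `D.toDual (2 • x)` vanishes on `Sel⁺ ∩ Str₂`
  rw [C_two_pow_succ_smul]
  refine hloc (2 • x) fun t ht ↦ ?_
  exact FineSandwich.toDual_two_nsmul_apply_eq_zero W κ 1 D x ((hkker x).1 hxk) t ht

/-! ## §3 The same in the PRINT SHAPE (zeta clause on the span of the genuine classes) -/

/-- **K3 BY NAME, MODULO PRINT, from the LOCALISED `2`-robust package IN THE SHAPE OF THE PRINT**: per habitat datum ONE
abstract local module `P` with `ι : P → Λ` (kernel killed by `2^m`) and ONE `col : 𝐇¹_Γ(T₂E) → P`; per pinned dual datum `D`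
(torsion) ONE `j : P → X⁺` with reciprocity `2^m · j ∘ col = 0` and the LOCAL cover «characters of `Sel⁺_∞` vanishing on
`Sel⁺_∞ ∩ Str₂` lie in `2^m · range j`»; and at every height-one `𝔭 ∌ 2` the zeta clause ON THE SPAN of the genuine `2`-adic
Euler-system classes. (`Y`, `k` and the global cover of `RobustZetaSpanPackageTwo` are DISCHARGED by `…FineRestriction` /
`…FineSandwich`; exponent `m + 1`; then `signedKatoDivisibilityUpToAtTwo_of_robustZetaSpanPackageTwo_of_pub`.)
[cite: Kobayashi2003, Thm. 6.2–6.3 (p. 11), (7.17)–(7.21), Thm. 7.3 (pp. 12–13)] [cite: Kato2004Asterisque, Thm. 12.5–12.6 (p. 222), Thm. 13.4 (2) (p. 226)]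
[cite: Sprung2012, Def. 6.1 (p. 1495), §7 (p. 1499)] [cite: GreenbergLNM1716, §2 Prop. 2.1 (p. 72)] [cite: Darmon2004, Thm. 3.22] -/
theorem signedKatoDivisibilityUpToAtTwo_of_localRobustZetaSpanPackageTwo_of_pub
    (h134 : Kato2004.thm13_4_two_lengthAt_fineSelmerDual_le_of_isEulerSystemClassTwo)
    (h17 : rank_eq_analyticRank_of_analyticRank_le_one)
    (hCK : ∀ (W : WeierstrassCurve ℚ) [W.IsElliptic] [W.IsGloballyMinimal],
      ¬ W.HasCM → W.analyticRank = 0 → GoodSS W 2 → W.frobeniusTrace 2 = 0 →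
      ∀ (κ : ZpExtension ℚ 2) (γ : Field.absoluteGaloisGroup ℚ) (hκ : κ.IsCyclotomic),
        κ.IsTopGenerator γ → IsCyclotomicVariable 2 γ →
        ∀ [NeZero (W.conductorNorm ℤ)] (f : CuspForm (Gamma0 (W.conductorNorm ℤ)) 2),
          IsNewformOf W f → ∀ (ϖ : ℚ), (ϖ : ℝ) * W.realPeriodRat = plusPeriod f →
        ∀ (Lplus Lminus : IwasawaAlgebra 2), IsPollackPair f 2 Lplus Lminus →
        ∀ [ContinuousSMul ℤ_[2] (W.tateModule 2)] [Module.Free ℤ_[2] (W.tateModule 2)]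
          [Module.Finite ℤ_[2] (W.tateModule 2)],
        ∃ (I : Kato2004.IwasawaH1Data W 2 κ γ)
          (P : Type) (_ : AddCommGroup P) (_ : _root_.Module (IwasawaAlgebra 2) P)
          (ι : P →ₗ[IwasawaAlgebra 2] IwasawaAlgebra 2) (col : I.H →ₗ[IwasawaAlgebra 2] P) (m : ℕ),
          (∀ y, ι y = 0 → (PowerSeries.C (2 : ℤ_[2]) : IwasawaAlgebra 2) ^ m • y = 0) ∧
          (∀ (D : SignedSelmerDualData W κ γ 1), Module.IsTorsion (IwasawaAlgebra 2) D.X →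
            ∃ (j : P →ₗ[IwasawaAlgebra 2] D.X),
              (∀ x, (PowerSeries.C (2 : ℤ_[2]) : IwasawaAlgebra 2) ^ m • j (col x) = 0) ∧
              (∀ x : D.X,
                (∀ t : signedSelmerInfty W κ 1,
                  (∀ (v : HeightOneSpectrum (𝓞 ℚ)) (hv : ((2 : ℕ) : 𝓞 ℚ) ∈ v.asIdeal) (σ : absoluteGaloisGroup ℚ),
                    conjH1 κ.kerSubgroup (W.geomPrimaryTorsion 2) σ (t : W.subgroupH1 2 κ.kerSubgroup) ∈
                      (fineData (W.geomPrimaryTorsion 2) 2 v hv).strictKer κ.kerSubgroup) →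
                  D.toDual x t = 0) →
                (PowerSeries.C (2 : ℤ_[2]) : IwasawaAlgebra 2) ^ m • x ∈ LinearMap.range j)) ∧
          (∀ 𝔭 : PrimeSpectrum (IwasawaAlgebra 2), 𝔭.asIdeal.height = 1 →
            PowerSeries.C (2 : ℤ_[2]) ∉ 𝔭.asIdeal →
            ∃ z ∈ Submodule.span (IwasawaAlgebra 2) {g : I.H | Kato2004.IsEulerSystemClassTwo W hκ I g},
              lengthAt (IwasawaAlgebra 2) (IwasawaAlgebra 2 ⧸ Ideal.span {ι (col z)}) 𝔭 ≤
                lengthAt (IwasawaAlgebra 2) (IwasawaAlgebra 2 ⧸ Ideal.span {kobayashiL 1 Lplus Lminus}) 𝔭)) :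
    SignedKatoDivisibilityUpToAtTwo := by
  refine signedKatoDivisibilityUpToAtTwo_of_robustZetaSpanPackageTwo_of_pub h134 h17
    fun W _ _ hcm hr hss ha κ γ hκ hγ hcv _ f hf ϖ hϖ Lplus Lminus hPP _ _ _ ↦ ?_
  obtain ⟨I, P, _, _, ι, col, m, hι, hPT, hZ⟩ := hCK W hcm hr hss ha κ γ hκ hγ hcv f hf ϖ hϖ Lplus Lminus hPP
  refine ⟨I, P, inferInstance, inferInstance, ι, col, m + 1, fun y hy ↦ C_two_pow_succ_smul_eq_zero (hι y hy),
    fun D hX ↦ ?_, hZ⟩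
  obtain ⟨j, hcj, hloc⟩ := hPT D hX
  let Y : W.FineSelmerDualData κ γ := W.fineSelmerDualData κ hγ
  obtain ⟨k, hk, -, hkker, -⟩ := FineRestriction.exists_fineRestrict_package W κ hγ D Y
  refine ⟨Y, j, k, fun x ↦ C_two_pow_succ_smul_eq_zero (hcj x), fun x hxk ↦ ?_⟩
  rw [C_two_pow_succ_smul]
  refine hloc (2 • x) fun t ht ↦ ?_
  exact FineSandwich.toDual_two_nsmul_apply_eq_zero W κ 1 D x ((hkker x).1 hxk) t ht

end AtTwo

end SignedKatoOffTwo

end Summit.BirchSwinnertonDyer.BirchSwinnertonDyer.Theorems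

end
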